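import Summits.AnomalousDissipation.AnomalousDissipation.Theorems.MomentParityQuarticGateModeCalculus
import Literature.Analysis.FluidPDE.SteadyGalerkinApprox

/-!
# Pair calculus of linearly polarised two-point coefficient families

Helper file for stub S6 (`stub_order2Design`) of the line `recession-cone` of crux
`MomentParity.QuarticGate`, continuing `MomentParityQuarticGateModeCalculus`. For the families
`M(k,a,v) = δ_k (a v) + δ_{-k} (ā v)` (the Fourier coefficients of the real mode `Re (e_k 2a v)`)
we evaluate the DIAGONAL quadratic forms of the design — energy `∑‖c k‖²`, enstrophy
`∑ |k|²‖c k‖²`, the helicity form `∑ Re⟪c k, s_k curlCoeff c k⟫` — on one family and on pairs of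
families with disjoint frequency supports, the vanishing of the convection symbol on pairs with
`v · k' = 0`, the expansion of a bi-additive form on a sum of three pairwise-orthogonal arguments,
the norm bound `‖perpVec k j‖ ≤ 1` of the Galerkin frame amplitudes, and the identification of the
frame fields `frameFieldIdx` with such families.
-/

namespace Summit.AnomalousDissipation.AnomalousDissipation.Theorems.MomentParityQuarticGate

open MeasureTheory Filter Complex
open scoped InnerProductSpace ComplexConjugate
open Literature.Analysis.FunctionSpaces Literature.Analysis.FluidPDE

set_option linter.dupNamespace false

/-! ## Bi-additive forms on three pairwise-orthogonal arguments -/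

/-- A bi-additive form on a sum of three arguments whose six cross terms vanish is the sum of the
three diagonal terms. [folklore] -/
theorem biadditive_apply_add_three {V W : Type*} [AddCommGroup V] [AddCommGroup W] (β : V → V → W)
    (hadd₁ : ∀ x y z, β (x + y) z = β x z + β y z) (hadd₂ : ∀ x y z, β x (y + z) = β x y + β x z)
    {x y z : V} (hxy : β x y = 0) (hxz : β x z = 0) (hyx : β y x = 0) (hyz : β y z = 0)
    (hzx : β z x = 0) (hzy : β z y = 0) :
    β (x + y + z) (x + y + z) = β x x + β y y + β z z := by
  simp only [hadd₁, hadd₂, hxy, hxz, hyx, hyz, hzx, hzy, add_zero, zero_add]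

/-- A bi-additive form on a sum of three arguments: the full nine-term expansion. [folklore] -/
theorem biadditive_apply_add_three_eq_sum {V W : Type*} [AddCommGroup V] [AddCommGroup W]
    (β : V → V → W)
    (hadd₁ : ∀ x y z, β (x + y) z = β x z + β y z) (hadd₂ : ∀ x y z, β x (y + z) = β x y + β x z)
    (x y z : V) :
    β (x + y + z) (x + y + z) =
      β x x + β x y + β x z + (β y x + β y y + β y z) + (β z x + β z y + β z z) := by
  simp only [hadd₁, hadd₂]

/-! ## Support of a two-point family -/

/-- The two-point family `δ_k u + δ_{-k} u'` vanishes off `{k, -k}`. [folklore] -/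
theorem single_add_single_apply_eq_zero {k κ : Fin 3 → ℤ} (hκ : κ ≠ k) (hκ' : κ ≠ -k)
    (u u' : EuclideanSpace ℂ (Fin 3)) :
    (Pi.single k u + Pi.single (-k) u' : (Fin 3 → ℤ) → EuclideanSpace ℂ (Fin 3)) κ = 0 := by
  simp [hκ, hκ']

/-- Two two-point families at frequencies `±k` and `±k'` with `k' ≠ ±k` have disjoint supports:
at every frequency one of them vanishes. [folklore] -/
theorem single_add_single_disjoint {k k' : Fin 3 → ℤ} (h₁ : k' ≠ k) (h₂ : k' ≠ -k)
    (u u' w w' : EuclideanSpace ℂ (Fin 3)) (κ : Fin 3 → ℤ) :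
    (Pi.single k u + Pi.single (-k) u' : (Fin 3 → ℤ) → EuclideanSpace ℂ (Fin 3)) κ = 0 ∨
      (Pi.single k' w + Pi.single (-k') w' : (Fin 3 → ℤ) → EuclideanSpace ℂ (Fin 3)) κ = 0 := by
  by_cases hκ : κ = k
  · subst hκ
    exact Or.inr (single_add_single_apply_eq_zero (Ne.symm h₁)
      (fun h => h₂ (by rw [h, neg_neg])) w w')
  · by_cases hκ' : κ = -k
    · subst hκ'
      exact Or.inr (single_add_single_apply_eq_zero (fun h => h₂ h.symm)
        (fun h => h₁ (neg_injective h).symm) w w')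
    · exact Or.inl (single_add_single_apply_eq_zero hκ hκ' u u')

/-! ## Transversality is preserved by sums and real multiples -/

/-- Transversality is preserved by sums. [folklore] -/
theorem isTransversal_add {S : Finset (Fin 3 → ℤ)} {c c' : (Fin 3 → ℤ) → EuclideanSpace ℂ (Fin 3)}
    (hc : Torus.IsTransversal S c) (hc' : Torus.IsTransversal S c') : Torus.IsTransversal S (c + c') := by
  intro k hk
  simp only [Pi.add_apply, PiLp.add_apply, mul_add, Finset.sum_add_distrib, hc k hk, hc' k hk, add_zero]

/-- Transversality is preserved by real scalar multiplication. [folklore] -/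
theorem isTransversal_real_smul {S : Finset (Fin 3 → ℤ)} {c : (Fin 3 → ℤ) → EuclideanSpace ℂ (Fin 3)}
    (hc : Torus.IsTransversal S c) (r : ℝ) : Torus.IsTransversal S (r • c) := by
  intro k hk
  simp only [Pi.smul_apply, PiLp.smul_apply, Complex.real_smul]
  simp_rw [show ∀ j, (k j : ℂ) * ((r : ℂ) * c k j) = (r : ℂ) * ((k j : ℂ) * c k j) from fun j => by ring,
    ← Finset.mul_sum, hc k hk, mul_zero]

/-- A family of two-point families with amplitudes summing to zero sums to zero:
`∑_m a_m = 0 ⟹ ∑_m M(k, a_m, v) = 0`. [folklore] -/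
theorem sum_polarised_eq_zero {ι : Type*} (s : Finset ι) (k : Fin 3 → ℤ) {a : ι → ℂ}
    (ha : ∑ m ∈ s, a m = 0) (v : EuclideanSpace ℝ (Fin 3)) :
    ∑ m ∈ s, (Pi.single k (a m • EuclideanSpace.complexify v) +
        Pi.single (-k) (conj (a m) • EuclideanSpace.complexify v) :
          (Fin 3 → ℤ) → EuclideanSpace ℂ (Fin 3)) = 0 := by
  have ha' : ∑ m ∈ s, conj (a m) = 0 := by rw [← map_sum, ha, map_zero]
  rw [Finset.sum_add_distrib]
  have h1 : ∑ m ∈ s, (Pi.single k (a m • EuclideanSpace.complexify v) :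
      (Fin 3 → ℤ) → EuclideanSpace ℂ (Fin 3)) =
      Pi.single k ((∑ m ∈ s, a m) • EuclideanSpace.complexify v) := by
    rw [Finset.sum_smul, ← AddMonoidHom.single_apply, map_sum]
    rfl
  have h2 : ∑ m ∈ s, (Pi.single (-k) (conj (a m) • EuclideanSpace.complexify v) :
      (Fin 3 → ℤ) → EuclideanSpace ℂ (Fin 3)) =
      Pi.single (-k) ((∑ m ∈ s, conj (a m)) • EuclideanSpace.complexify v) := by
    rw [Finset.sum_smul, ← AddMonoidHom.single_apply, map_sum]
    rfl
  rw [h1, h2, ha, ha', zero_smul, Pi.single_zero, Pi.single_zero, add_zero]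

/-- **Sum over the design index set** `Fin 4 × A × Bool × Bool` of atoms `x m ± q ± r a`: the two
signs cancel and `∑ = (4 · #A) • ∑_m x m`. [folklore] -/
theorem sum_index_atoms {V : Type*} [AddCommGroup V] [Module ℝ V] {A : Type*} [Fintype A]
    (x : Fin 4 → V) (q : V) (r : A → V) :
    ∑ p : Fin 4 × A × Bool × Bool,
        (x p.1 + (if p.2.2.1 then (1 : ℝ) else -1) • q + (if p.2.2.2 then (1 : ℝ) else -1) • r p.2.1) =
      ((4 * Fintype.card A : ℕ) : ℝ) • ∑ m, x m := by
  simp only [Fintype.sum_prod_type, Fintype.sum_bool, Bool.false_eq_true, ↓reduceIte, one_smul, neg_one_smul]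
  have h : ∀ (m : Fin 4) (a : A),
      x m + q + r a + (x m + q + -r a) + (x m + -q + r a + (x m + -q + -r a)) = (4 : ℕ) • x m := by
    intro m a
    abel
  simp_rw [h, Finset.sum_const, Finset.card_univ, smul_smul, ← Finset.smul_sum, Nat.cast_smul_eq_nsmul]
  rw [mul_comm]

/-! ## Diagonal forms -/

/-- **A diagonal form vanishes on families with disjoint supports**: if at every frequency `c` or
`c'` vanishes and `T k 0 = 0`, then `∑_{k∈S} Re ⟪c k, T k (c' k)⟫ = 0`. [folklore] -/
theorem sum_re_inner_eq_zero_of_disjoint {S : Finset (Fin 3 → ℤ)}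
    {c c' : (Fin 3 → ℤ) → EuclideanSpace ℂ (Fin 3)}
    (T : (Fin 3 → ℤ) → EuclideanSpace ℂ (Fin 3) → EuclideanSpace ℂ (Fin 3)) (hT : ∀ k, T k 0 = 0)
    (h : ∀ k, c k = 0 ∨ c' k = 0) :
    ∑ k ∈ S, (inner ℂ (c k) (T k (c' k))).re = 0 := by
  refine Finset.sum_eq_zero fun k _ => ?_
  rcases h k with hk | hk
  · rw [hk, inner_zero_left, Complex.zero_re]
  · rw [hk, hT, inner_zero_right, Complex.zero_re]

/-- **Energy of a two-point family**: `∑_{κ∈S} ‖M(k,a,v) κ‖² = 2 ‖a‖² ‖v‖²` for `k ≠ 0`, `±k ∈ S`.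
[folklore] -/
theorem sum_norm_sq_polarised {S : Finset (Fin 3 → ℤ)} {k : Fin 3 → ℤ} (hk : k ∈ S) (hnk : -k ∈ S)
    (hk0 : k ≠ 0) (a : ℂ) (v : EuclideanSpace ℝ (Fin 3)) :
    ∑ κ ∈ S, ‖(Pi.single k (a • EuclideanSpace.complexify v) +
        Pi.single (-k) (conj a • EuclideanSpace.complexify v) :
          (Fin 3 → ℤ) → EuclideanSpace ℂ (Fin 3)) κ‖ ^ 2 = 2 * ‖a‖ ^ 2 * ‖v‖ ^ 2 := by
  have hkk : k ≠ -k := fun h => hk0 (by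
    have h2 : k + k = 0 := by nth_rewrite 2 [h]; exact add_neg_cancel k
    have : (2 : ℤ) • k = 0 := by rw [two_smul]; exact h2
    exact (smul_eq_zero.1 this).resolve_left two_ne_zero)
  rw [sum_norm_sq_single_add_single hkk hk hnk, norm_smul, norm_smul, Complex.norm_conj,
    EuclideanSpace.norm_complexify]
  ring

/-- **Enstrophy of a two-point family**: `∑_{κ∈S} |κ|² ‖M(k,a,v) κ‖² = 2 |k|² ‖a‖² ‖v‖²`
(`k ≠ 0`, `±k ∈ S`). [folklore] -/
theorem sum_freqNormSq_mul_norm_sq_polarised {S : Finset (Fin 3 → ℤ)} {k : Fin 3 → ℤ} (hk : k ∈ S)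
    (hnk : -k ∈ S) (hk0 : k ≠ 0) (a : ℂ) (v : EuclideanSpace ℝ (Fin 3)) :
    ∑ κ ∈ S, Torus.freqNormSq κ * ‖(Pi.single k (a • EuclideanSpace.complexify v) +
        Pi.single (-k) (conj a • EuclideanSpace.complexify v) :
          (Fin 3 → ℤ) → EuclideanSpace ℂ (Fin 3)) κ‖ ^ 2 =
      2 * Torus.freqNormSq k * ‖a‖ ^ 2 * ‖v‖ ^ 2 := by
  have hkk : k ≠ -k := fun h => hk0 (by
    have h2 : k + k = 0 := by nth_rewrite 2 [h]; exact add_neg_cancel k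
    have : (2 : ℤ) • k = 0 := by rw [two_smul]; exact h2
    exact (smul_eq_zero.1 this).resolve_left two_ne_zero)
  rw [sum_freqNormSq_mul_norm_sq_single_add_single hkk hk hnk, norm_smul, norm_smul, Complex.norm_conj,
    EuclideanSpace.norm_complexify, Torus.freqNormSq_neg]
  ring

/-- **The helicity form vanishes on a linearly polarised two-point family** (same direction `v`
at `k` and `-k`): `∑_{κ∈S} Re ⟪M κ, s κ • curlCoeff M' κ⟫ = 0` for `M = M(k,a,v)`, `M' = M(k,a',v)`.
[folklore] -/
theorem sum_re_inner_smul_curlCoeff_polarised (S : Finset (Fin 3 → ℤ)) (k : Fin 3 → ℤ) (a a' : ℂ)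
    (v : EuclideanSpace ℝ (Fin 3)) (s : (Fin 3 → ℤ) → ℂ) :
    ∑ κ ∈ S, (inner ℂ ((Pi.single k (a • EuclideanSpace.complexify v) +
        Pi.single (-k) (conj a • EuclideanSpace.complexify v) :
          (Fin 3 → ℤ) → EuclideanSpace ℂ (Fin 3)) κ)
      (s κ • IntermittentBeltrami.curlCoeff (Pi.single k (a' • EuclideanSpace.complexify v) +
        Pi.single (-k) (conj a' • EuclideanSpace.complexify v) :
          (Fin 3 → ℤ) → EuclideanSpace ℂ (Fin 3)) κ)).re = 0 := by
  refine Finset.sum_eq_zero fun κ _ => ?_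
  rw [single_add_single_apply, inner_smul_right,
    inner_curlCoeff_eq_zero_of_parallel (single_add_single_apply k κ a' _), mul_zero, Complex.zero_re]

/-- Weighted squared norms as real parts of weighted self-pairings:
`∑ r_k ‖c k‖² = ∑ Re ⟪c k, r_k • c k⟫`. [folklore] -/
theorem sum_mul_norm_sq_eq_sum_re_inner (S : Finset (Fin 3 → ℤ)) (r : (Fin 3 → ℤ) → ℝ)
    (c : (Fin 3 → ℤ) → EuclideanSpace ℂ (Fin 3)) :
    ∑ k ∈ S, r k * ‖c k‖ ^ 2 = ∑ k ∈ S, (inner ℂ (c k) (((r k : ℝ) : ℂ) • c k)).re := by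
  refine Finset.sum_congr rfl fun k _ => ?_
  have hself : (inner ℂ (c k) (c k)).re = ‖c k‖ ^ 2 := by
    have := inner_self_eq_norm_sq (𝕜 := ℂ) (c k)
    rwa [RCLike.re_to_complex] at this
  rw [inner_smul_right, Complex.re_ofReal_mul, hself]

/-- **The weighted pairing form is bi-additive and odd** in each argument
(`β(c, c') = ∑_{k∈S} Re ⟪c k, w_k • c' k⟫`). [folklore] -/
theorem weightedForm_biadditive (S : Finset (Fin 3 → ℤ)) (w : (Fin 3 → ℤ) → ℂ) :
    (∀ x y z : (Fin 3 → ℤ) → EuclideanSpace ℂ (Fin 3),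
        ∑ k ∈ S, (inner ℂ ((x + y) k) (w k • z k)).re =
          ∑ k ∈ S, (inner ℂ (x k) (w k • z k)).re + ∑ k ∈ S, (inner ℂ (y k) (w k • z k)).re) ∧
      (∀ x y z : (Fin 3 → ℤ) → EuclideanSpace ℂ (Fin 3),
        ∑ k ∈ S, (inner ℂ (x k) (w k • (y + z) k)).re =
          ∑ k ∈ S, (inner ℂ (x k) (w k • y k)).re + ∑ k ∈ S, (inner ℂ (x k) (w k • z k)).re) ∧
      (∀ x z : (Fin 3 → ℤ) → EuclideanSpace ℂ (Fin 3),
        ∑ k ∈ S, (inner ℂ ((-x) k) (w k • z k)).re = -∑ k ∈ S, (inner ℂ (x k) (w k • z k)).re) ∧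
      (∀ x z : (Fin 3 → ℤ) → EuclideanSpace ℂ (Fin 3),
        ∑ k ∈ S, (inner ℂ (x k) (w k • (-z) k)).re = -∑ k ∈ S, (inner ℂ (x k) (w k • z k)).re) := by
  refine ⟨fun x y z => ?_, fun x y z => ?_, fun x z => ?_, fun x z => ?_⟩
  · simp only [Pi.add_apply, inner_add_left, Complex.add_re, Finset.sum_add_distrib]
  · simp only [Pi.add_apply, smul_add, inner_add_right, Complex.add_re, Finset.sum_add_distrib]
  · simp only [Pi.neg_apply, inner_neg_left, Complex.neg_re, Finset.sum_neg_distrib]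
  · simp only [Pi.neg_apply, smul_neg, inner_neg_right, Complex.neg_re, Finset.sum_neg_distrib]

/-- **The helicity form is bi-additive and odd** in each argument
(`β(c, c') = ∑_{k∈S} Re ⟪c k, w_k • curlCoeff c' k⟫`). [folklore] -/
theorem curlForm_biadditive (S : Finset (Fin 3 → ℤ)) (w : (Fin 3 → ℤ) → ℂ) :
    (∀ x y z : (Fin 3 → ℤ) → EuclideanSpace ℂ (Fin 3),
        ∑ k ∈ S, (inner ℂ ((x + y) k) (w k • IntermittentBeltrami.curlCoeff z k)).re =
          ∑ k ∈ S, (inner ℂ (x k) (w k • IntermittentBeltrami.curlCoeff z k)).re +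
            ∑ k ∈ S, (inner ℂ (y k) (w k • IntermittentBeltrami.curlCoeff z k)).re) ∧
      (∀ x y z : (Fin 3 → ℤ) → EuclideanSpace ℂ (Fin 3),
        ∑ k ∈ S, (inner ℂ (x k) (w k • IntermittentBeltrami.curlCoeff (y + z) k)).re =
          ∑ k ∈ S, (inner ℂ (x k) (w k • IntermittentBeltrami.curlCoeff y k)).re +
            ∑ k ∈ S, (inner ℂ (x k) (w k • IntermittentBeltrami.curlCoeff z k)).re) ∧
      (∀ x z : (Fin 3 → ℤ) → EuclideanSpace ℂ (Fin 3),
        ∑ k ∈ S, (inner ℂ ((-x) k) (w k • IntermittentBeltrami.curlCoeff z k)).re =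
          -∑ k ∈ S, (inner ℂ (x k) (w k • IntermittentBeltrami.curlCoeff z k)).re) ∧
      (∀ x z : (Fin 3 → ℤ) → EuclideanSpace ℂ (Fin 3),
        ∑ k ∈ S, (inner ℂ (x k) (w k • IntermittentBeltrami.curlCoeff (-z) k)).re =
          -∑ k ∈ S, (inner ℂ (x k) (w k • IntermittentBeltrami.curlCoeff z k)).re) := by
  refine ⟨fun x y z => ?_, fun x y z => ?_, fun x z => ?_, fun x z => ?_⟩
  · simp only [Pi.add_apply, inner_add_left, Complex.add_re, Finset.sum_add_distrib]
  · simp only [curlCoeff_add, smul_add, inner_add_right, Complex.add_re, Finset.sum_add_distrib]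
  · simp only [Pi.neg_apply, inner_neg_left, Complex.neg_re, Finset.sum_neg_distrib]
  · simp only [curlCoeff_neg, smul_neg, inner_neg_right, Complex.neg_re, Finset.sum_neg_distrib]

/-- **The helicity form vanishes on families with disjoint supports.** [folklore] -/
theorem curlForm_eq_zero_of_disjoint {S : Finset (Fin 3 → ℤ)} (w : (Fin 3 → ℤ) → ℂ)
    {c c' : (Fin 3 → ℤ) → EuclideanSpace ℂ (Fin 3)} (h : ∀ k, c k = 0 ∨ c' k = 0) :
    ∑ k ∈ S, (inner ℂ (c k) (w k • IntermittentBeltrami.curlCoeff c' k)).re = 0 := by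
  refine Finset.sum_eq_zero fun k _ => ?_
  rcases h k with hk | hk
  · rw [hk, inner_zero_left, Complex.zero_re]
  · rw [curlCoeff_apply_eq_zero hk, smul_zero, inner_zero_right, Complex.zero_re]

/-- **The convection symbol is bi-additive and odd** (function form). [folklore] -/
theorem convectionCoeff_biadditive (S : Finset (Fin 3 → ℤ)) :
    (∀ x y z : (Fin 3 → ℤ) → EuclideanSpace ℂ (Fin 3),
        Torus.convectionCoeff S (x + y) z = Torus.convectionCoeff S x z + Torus.convectionCoeff S y z) ∧
      (∀ x y z : (Fin 3 → ℤ) → EuclideanSpace ℂ (Fin 3),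
        Torus.convectionCoeff S x (y + z) = Torus.convectionCoeff S x y + Torus.convectionCoeff S x z) ∧
      (∀ x z : (Fin 3 → ℤ) → EuclideanSpace ℂ (Fin 3),
        Torus.convectionCoeff S (-x) z = -Torus.convectionCoeff S x z) ∧
      (∀ x z : (Fin 3 → ℤ) → EuclideanSpace ℂ (Fin 3),
        Torus.convectionCoeff S x (-z) = -Torus.convectionCoeff S x z) := by
  refine ⟨fun x y z => funext fun k => Torus.convectionCoeff_add_left S x y z k,
    fun x y z => funext fun k => Torus.convectionCoeff_add_right S x y z k,
    fun x z => funext fun k => ?_, fun x z => funext fun k => ?_⟩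
  · rw [← neg_one_smul ℂ x, Torus.convectionCoeff_smul_left, Pi.neg_apply, neg_one_smul]
  · rw [← neg_one_smul ℂ z, Torus.convectionCoeff_smul_right, Pi.neg_apply, neg_one_smul]

/-! ## The convection symbol on pairs of two-point families -/

/-- **The convection symbol of two two-point families vanishes when the advecting direction is
orthogonal to the advected frequency**: `v · k' = 0 ⟹ convectionCoeff S M(k,a,v) M(k',a',v') = 0`.
[folklore] -/
theorem convectionCoeff_polarised_eq_zero (S : Finset (Fin 3 → ℤ)) (k : Fin 3 → ℤ) {k' : Fin 3 → ℤ}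
    (a a' : ℂ) {v : EuclideanSpace ℝ (Fin 3)} (v' : EuclideanSpace ℝ (Fin 3))
    (hvk' : ∑ j, v j * (k' j : ℝ) = 0) :
    Torus.convectionCoeff S (Pi.single k (a • EuclideanSpace.complexify v) +
        Pi.single (-k) (conj a • EuclideanSpace.complexify v) : (Fin 3 → ℤ) → EuclideanSpace ℂ (Fin 3))
      (Pi.single k' (a' • EuclideanSpace.complexify v') +
        Pi.single (-k') (conj a' • EuclideanSpace.complexify v') :
          (Fin 3 → ℤ) → EuclideanSpace ℂ (Fin 3)) = 0 := by
  have hC : ∑ j, (v j : ℂ) * (k' j : ℂ) = 0 := by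
    have := congrArg (fun r : ℝ => (r : ℂ)) hvk'
    push_cast at this
    exact this
  have hdot : ∀ (b : ℂ) (m : Fin 3 → ℤ), (m = k' ∨ m = -k') →
      ∑ j, (b • EuclideanSpace.complexify v) j * (m j : ℂ) = 0 := by
    intro b m hm
    have hm' : ∑ j, (v j : ℂ) * (m j : ℂ) = 0 := by
      rcases hm with rfl | rfl
      · exact hC
      · simp only [Pi.neg_apply, Int.cast_neg, mul_neg, Finset.sum_neg_distrib, hC, neg_zero]
    simp_rw [PiLp.smul_apply, EuclideanSpace.complexify_apply, smul_eq_mul, mul_assoc, ← Finset.mul_sum,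
      hm', mul_zero]
  funext κ
  rw [Torus.convectionCoeff_add_left, Torus.convectionCoeff_add_right, Torus.convectionCoeff_add_right,
    convectionCoeff_single_single_eq_zero S k (hdot a k' (Or.inl rfl)),
    convectionCoeff_single_single_eq_zero S k (hdot a (-k') (Or.inr rfl)),
    convectionCoeff_single_single_eq_zero S (-k) (hdot (conj a) k' (Or.inl rfl)),
    convectionCoeff_single_single_eq_zero S (-k) (hdot (conj a) (-k') (Or.inr rfl))]
  simp

/-! ## The Galerkin frame amplitudes -/

/-- **The frame amplitudes have norm at most one**: `‖perpVec k j‖² = 1 - k_j²/|k|² ≤ 1`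
(`perpVec k j` is the orthogonal projection of `e_j` onto `k^⊥`). [folklore] -/
theorem norm_sq_perpVec_le (k : Fin 3 → ℤ) (j : Fin 3) : ‖Torus.perpVec k j‖ ^ 2 ≤ 1 := by
  set t : ℝ := (k j : ℝ) / Torus.freqNormSq k with ht
  have hcoord : ∀ i, Torus.perpVec k j i = (if i = j then 1 else 0) - t * k i := fun i =>
    Torus.perpVec_apply k j i
  rw [EuclideanSpace.real_norm_sq_eq]
  simp_rw [hcoord]
  have hexp : ∑ i : Fin 3, ((if i = j then (1 : ℝ) else 0) - t * k i) ^ 2 =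
      1 - 2 * t * k j + t ^ 2 * Torus.freqNormSq k := by
    have h1 : ∑ i : Fin 3, ((if i = j then (1 : ℝ) else 0) - t * k i) ^ 2 =
        ∑ i : Fin 3, ((if i = j then (1 : ℝ) else 0) - 2 * t * (if i = j then (k i : ℝ) else 0) +
          t ^ 2 * ((k i : ℝ)) ^ 2) := Finset.sum_congr rfl fun i _ => by split_ifs <;> ring
    rw [h1, Finset.sum_add_distrib, Finset.sum_sub_distrib, Finset.sum_ite_eq' Finset.univ j,
      ← Finset.mul_sum, Finset.sum_ite_eq' Finset.univ j, ← Finset.mul_sum]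
    simp only [Finset.mem_univ, if_true]
    rfl
  rw [hexp]
  by_cases hk : Torus.freqNormSq k = 0
  · rw [ht, hk, div_zero]
    simp
  · have hpos : 0 < Torus.freqNormSq k := lt_of_le_of_ne (Torus.freqNormSq_nonneg k) (Ne.symm hk)
    have htk : t * Torus.freqNormSq k = k j := by rw [ht, div_mul_cancel₀ _ hk]
    have : t ^ 2 * Torus.freqNormSq k = t * k j := by rw [sq, mul_assoc, htk]
    rw [this]
    have : 0 ≤ t * k j := by
      rw [ht, div_mul_eq_mul_div]
      exact div_nonneg (mul_self_nonneg _) hpos.le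
    linarith

/-- The frame amplitude `frameVec k j c` is the phase `1` (cosine) or `-i` (sine) times the
complexified `perpVec k j`. [folklore] -/
theorem frameVec_eq_smul (k : Fin 3 → ℤ) (j : Fin 3) (c : Bool) :
    Torus.frameVec k j c = (if c then (1 : ℂ) else -Complex.I) • EuclideanSpace.complexify (Torus.perpVec k j) := by
  cases c
  · rfl
  · simp [Torus.frameVec]

/-- **The frame fields are single real modes of two-point families**: for a frame index
`a = (k, j, c)` at level `N` and a real amplitude `η`,
`realTrigPoly S M(k, (η/2)·phase_c, perpVec k j) = η • frameFieldIdx N a`, `S = (freqBall N).erase 0`.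
[folklore] -/
theorem realTrigPoly_polarised_frame (N : ℕ) (a : Torus.FrameIdx (Fin 3) N) (η : ℝ) :
    Torus.realTrigPoly ((Torus.freqBall N).erase 0)
      (Pi.single (a.1 : Fin 3 → ℤ) ((((η / 2 : ℝ) : ℂ) * (if a.2.2 then (1 : ℂ) else -Complex.I)) •
          EuclideanSpace.complexify (Torus.perpVec (a.1 : Fin 3 → ℤ) a.2.1)) +
        Pi.single (-(a.1 : Fin 3 → ℤ)) (conj (((η / 2 : ℝ) : ℂ) * (if a.2.2 then (1 : ℂ) else -Complex.I)) •
          EuclideanSpace.complexify (Torus.perpVec (a.1 : Fin 3 → ℤ) a.2.1)) :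
        (Fin 3 → ℤ) → EuclideanSpace ℂ (Fin 3)) =
      fun x => η • Torus.frameFieldIdx N a x := by
  have hk : (a.1 : Fin 3 → ℤ) ∈ (Torus.freqBall N).erase 0 := a.1.2
  have hnk : -(a.1 : Fin 3 → ℤ) ∈ (Torus.freqBall N).erase 0 := neg_mem_freqBall_erase_zero _ hk
  have hk0 : (a.1 : Fin 3 → ℤ) ≠ 0 := Torus.ne_zero_of_mem_freqBall₀ _
  have hdiv : ((η / 2 : ℝ) : ℂ) * (if a.2.2 then (1 : ℂ) else -Complex.I) =
      (((η : ℝ) : ℂ) * (if a.2.2 then (1 : ℂ) else -Complex.I)) / 2 := by push_cast; ring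
  rw [hdiv, realTrigPoly_single_add_single hk hnk hk0]
  funext x
  rw [Torus.frameFieldIdx, Torus.frameField, frameVec_eq_smul, ← IntermittentBeltrami.realTrigPoly_ofReal_smul]
  simp_rw [smul_smul]

/-- **Registered sub-goal `pairCalculus_norm_sq_perpVec_le` of stub S6** (summary of this file):
the Galerkin frame amplitudes `perpVec k j` have norm at most one. [folklore] -/
theorem pairCalculus_norm_sq_perpVec_le : ∀ (k : Fin 3 → ℤ) (j : Fin 3), ‖Torus.perpVec k j‖ ^ 2 ≤ 1 :=
  norm_sq_perpVec_le

end Summit.AnomalousDissipation.AnomalousDissipation.Theorems.MomentParityQuarticGate
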